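import Summits.AtomisticToContinuum.FouriersLaw.Theorems.BondHeatUncertaintySubdiffusiveBondHeatAnharmonicityWindowLadder
import Summits.AtomisticToContinuum.FouriersLaw.Theorems.BondHeatUncertaintySubdiffusiveBondHeatDeficitCesaroLinear
import Summits.AtomisticToContinuum.FouriersLaw.Theorems.BondHeatUncertaintyLightConeBondHeatGreenKuboDip

/-!
# `KineticCorrectorBudget` ladder — the FREE AFFINE CEILING proved for `N ≥ 2` (decomp-a2c hand-1 g18, critic row 680 GO)

The rung `AffineCorrectorCeiling` of `…Theorems.BondHeatUncertaintySubdiffusiveBondHeatAnharmonicityWindowLadder` (lens-1 g54,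
landed p840787) quantifies over EVERY `N`; its by-name route (EXCERPT-g54 §1) runs through the bath bond `(0,1)` and therefore
carries `1 < N`.  This file proves the `N ≥ 2` form

  `affineCorrectorCeiling_two : ∀ ω₂ lam β γ > 0, ∀ T > 0, ∃ B, ∀ N ≥ 2, ∀ τ ≥ 0, ‖g^τ_{N,T}‖² ≤ (2T²/γ)·τ + B`,  `B = 4σ²/γ²`,

and the horizon seam at `N₀ = 2` (`horizonCorrectorBudget_of_affineCeiling_two_of_le_one`: every rung `KCB^{(s)}`, `s ≤ 1`).
Route: (a) CONDITIONAL JENSEN for the path law — `g^τ(z) = ∫₀^τ (P_u θ₀)(z) du = E_W[X_z]`, `X_z(ω) = ∫₀^τ θ₀(Φ_u(z, Bω)) du`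
(`pinnedChain_integral_transitionKernel` + Fubini on `W ⊗ Leb↾(0,τ]`, for `μ_T`-a.e. `z`), `(E_W X_z)² ≤ E_W X_z²` (variance ≥ 0), so
`‖g^τ‖² ≤ E_{μ_T⊗W}[X²]`; (b) `E_{μ_T⊗W}[X²] = 2∫₀^τ (τ − r) K_N(r) dr = 2∫₀^τ∫₀ˢ K_N` (`pinnedChain_timeIntegral_sq`,
`pinnedChain_primitive_kinKernel_integral_eq`) `= (2T²/γ)·(τ − W_N(τ))`, `W_N(τ) = ∫₀^τ (1 − (γ/T²)∫₀ˢ K_N)`; (c) the landed bath-bond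
reduction `0 ≤ V_N(0,τ) ≤ 4γT²·W_N(τ) + 8E[e₀²]` (`pinnedChain_bondHeatVar_nonneg`, `stub_bathBondReduction_of_kernelFacts` with the landed
kernel facts) and `E[e₀²] ≤ σ²` (`localEnergyMoment`) give `−W_N(τ) ≤ 2σ²/(γT²)`.  No definitions, no `sorry`, standard axioms.
`--supports stmt-AtomisticToContinuum-9120`.
-/

noncomputable section

open MeasureTheory ProbabilityTheory Set Filter Topology intervalIntegral
open scoped NNReal

namespace Summit.AtomisticToContinuum.FouriersLaw.Theorems.SubdiffusiveBondHeat.CorrectorBudget.Ladder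

open Literature.MathematicalPhysics.KineticTheory.HeatConduction
open Literature.Probability.Process
open Summit.AtomisticToContinuum.FouriersLaw.Theorems.SubdiffusiveBondHeat
open Summit.AtomisticToContinuum.FouriersLaw.Theorems.LightConeBondHeat (pinnedChain_bondHeatVar_nonneg)

/-! ## §1  Conditional Jensen for the path law -/

section Jensen

variable {ω₂ lam β γ T : ℝ} (hω : 0 < ω₂) (hl : 0 < lam) (hβ : 0 < β) (hγ : 0 < γ) (hT : 0 < T) {N : ℕ} (hN : 0 < N)
include hω hl hβ hγ hT hN

/-- **`‖g^τ‖² ≤ E_{μ_T⊗W}[(∫₀^τ θ₀(z_u) du)²]`** for `τ ≥ 0`: the corrector `g^τ = ∫₀^τ P_u θ₀ du` is the `W`-average of the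
time integral `X = ∫₀^τ θ₀(Φ_u(z,B)) du` (`pinnedChain_integral_transitionKernel` + Fubini, `μ_T`-a.e. `z`), and `(E_W X)² ≤ E_W X²`.
[this file] -/
theorem correctorNormSq_le_timeIntegral_sq {τ : ℝ} (hτ : 0 ≤ τ) :
    ∫ z, (∫ u in (0 : ℝ)..τ, ∫ y, ((y.2 ⟨0, hN⟩) ^ 2 - T)
        ∂((pinnedChain ω₂ lam β γ).transitionKernel N T T u.toNNReal z)) ^ 2
      ∂((pinnedChain ω₂ lam β γ).gibbsMeasure N T) ≤
    ∫ p, (∫ u in (0 : ℝ)..τ, (fun y : PhaseSpace N => (y.2 ⟨0, hN⟩) ^ 2 - T)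
        ((pinnedChain ω₂ lam β γ).solMap N T T u p.1 (pairPath p.2))) ^ 2
      ∂(((pinnedChain ω₂ lam β γ).gibbsMeasure N T).prod wienerPair) := by
  set θ : PhaseSpace N → ℝ := fun y => (y.2 ⟨0, hN⟩) ^ 2 - T with hθ
  have hinv : ∀ s : ℝ≥0, ((pinnedChain ω₂ lam β γ).gibbsMeasure N T).bind ((pinnedChain ω₂ lam β γ).transitionKernel N T T s) =
      (pinnedChain ω₂ lam β γ).gibbsMeasure N T := fun s =>
    pinnedChain_gibbsMeasure_bind_transitionKernel hω hl.le hβ.le hγ.le hN hT s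
  haveI : IsProbabilityMeasure ((pinnedChain ω₂ lam β γ).gibbsMeasure N T) :=
    pinnedChain_isProbabilityMeasure_gibbsMeasure hω hl.le hβ.le γ N hT
  have hθm : Measurable θ := by fun_prop
  have hθ2 : Integrable (fun y => θ y ^ 2) ((pinnedChain ω₂ lam β γ).gibbsMeasure N T) :=
    pinnedChain_integrable_sq_kinObs₀ (γ := γ) hω hl hβ hT hN
  -- the time integral `X`; `X²` is integrable on `μ ⊗ W`
  set X : PhaseSpace N × WienerPair → ℝ := fun p =>
    ∫ u in (0 : ℝ)..τ, θ ((pinnedChain ω₂ lam β γ).solMap N T T u p.1 (pairPath p.2)) with hX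
  have hX2i : Integrable (fun p => X p ^ 2) (((pinnedChain ω₂ lam β γ).gibbsMeasure N T).prod wienerPair) := by
    have h := pinnedChain_integrable_intervalIntegral_mul_of_invariant hω hl.le hβ.le hγ.le N T T
      ((pinnedChain ω₂ lam β γ).gibbsMeasure N T) hinv hθm hθm hθ2 hθ2 hτ
    refine h.congr (ae_of_all _ fun p => ?_)
    simp only [hX, sq]
  -- joint integrability of `θ(z_u(p))` on `(μ ⊗ W) ⊗ Leb↾(0,τ]`, re-associated to `μ ⊗ (W ⊗ Leb↾(0,τ])`
  set L : Measure ℝ := (volume : Measure ℝ).restrict (Ioc 0 τ) with hL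
  have hG := pinnedChain_integrable_uncurry_pointTime_of_invariant hω hl.le hβ.le hγ.le N T T
    ((pinnedChain ω₂ lam β γ).gibbsMeasure N T) hinv (k := fun _ => (1 : ℝ)) hθm measurable_const hθ2 (by simp) 0 τ
  have hG' : Integrable (fun w : (PhaseSpace N × WienerPair) × ℝ =>
      θ ((pinnedChain ω₂ lam β γ).solMap N T T w.2 w.1.1 (pairPath w.1.2)))
      ((((pinnedChain ω₂ lam β γ).gibbsMeasure N T).prod wienerPair).prod L) :=
    hG.congr (ae_of_all _ fun q => by simp [Function.uncurry])
  -- `X ∈ L¹(μ ⊗ W)` (integrate out the time)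
  have hXi : Integrable X (((pinnedChain ω₂ lam β γ).gibbsMeasure N T).prod wienerPair) := by
    refine hG'.integral_prod_left.congr (ae_of_all _ fun p => ?_)
    simp only [hX]
    rw [integral_of_le hτ]
  have hmp : MeasurePreserving (MeasurableEquiv.prodAssoc (α := PhaseSpace N) (β := WienerPair) (γ := ℝ)).symm
      (((pinnedChain ω₂ lam β γ).gibbsMeasure N T).prod (wienerPair.prod L))
      ((((pinnedChain ω₂ lam β γ).gibbsMeasure N T).prod wienerPair).prod L) :=
    (measurePreserving_prodAssoc ((pinnedChain ω₂ lam β γ).gibbsMeasure N T) wienerPair L).symm _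
  have hF : Integrable (fun w : PhaseSpace N × (WienerPair × ℝ) =>
      θ ((pinnedChain ω₂ lam β γ).solMap N T T w.2.2 w.1 (pairPath w.2.1)))
      (((pinnedChain ω₂ lam β γ).gibbsMeasure N T).prod (wienerPair.prod L)) := by
    have h := (hmp.integrable_comp_emb (MeasurableEquiv.measurableEmbedding _)).2 hG'
    exact h.congr (ae_of_all _ fun w => rfl)
  -- a.e. in `z`: the `(ω, u)`-section is integrable, and the `ω`-sections of `X`, `X²` are integrable
  have hae1 : ∀ᵐ z ∂((pinnedChain ω₂ lam β γ).gibbsMeasure N T), Integrable (fun q : WienerPair × ℝ =>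
      θ ((pinnedChain ω₂ lam β γ).solMap N T T q.2 z (pairPath q.1))) (wienerPair.prod L) :=
    hF.prod_right_ae
  have hae2 : ∀ᵐ z ∂((pinnedChain ω₂ lam β γ).gibbsMeasure N T), Integrable (fun ω => X (z, ω)) wienerPair :=
    hXi.prod_right_ae
  have hae3 : ∀ᵐ z ∂((pinnedChain ω₂ lam β γ).gibbsMeasure N T), Integrable (fun ω => X (z, ω) ^ 2) wienerPair :=
    hX2i.prod_right_ae
  -- the pointwise (a.e.) inequality `g(z)² ≤ E_W[X_z²]`
  have hpt : ∀ᵐ z ∂((pinnedChain ω₂ lam β γ).gibbsMeasure N T),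
      (∫ u in (0 : ℝ)..τ, ∫ y, θ y ∂((pinnedChain ω₂ lam β γ).transitionKernel N T T u.toNNReal z)) ^ 2 ≤
        ∫ ω, X (z, ω) ^ 2 ∂wienerPair := by
    filter_upwards [hae1, hae2, hae3] with z h1 h2 h3
    -- identification `g(z) = E_W[X_z]`
    have hid : ∫ u in (0 : ℝ)..τ, ∫ y, θ y ∂((pinnedChain ω₂ lam β γ).transitionKernel N T T u.toNNReal z) =
        ∫ ω, X (z, ω) ∂wienerPair := by
      have hswap := integral_integral_swap
        (f := fun (ω : WienerPair) (u : ℝ) => θ ((pinnedChain ω₂ lam β γ).solMap N T T u z (pairPath ω))) h1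
      calc ∫ u in (0 : ℝ)..τ, ∫ y, θ y ∂((pinnedChain ω₂ lam β γ).transitionKernel N T T u.toNNReal z)
          = ∫ u in Ioc 0 τ, ∫ ω, θ ((pinnedChain ω₂ lam β γ).solMap N T T u z (pairPath ω)) ∂wienerPair := by
            rw [integral_of_le hτ]
            refine setIntegral_congr_fun measurableSet_Ioc fun u hu => ?_
            have hu' : ((u.toNNReal : ℝ≥0) : ℝ) = u := Real.coe_toNNReal u hu.1.le
            rw [pinnedChain_integral_transitionKernel hω hl.le hβ.le hγ.le N T T u.toNNReal z hθm.aestronglyMeasurable, hu']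
        _ = ∫ ω, (∫ u in Ioc 0 τ, θ ((pinnedChain ω₂ lam β γ).solMap N T T u z (pairPath ω))) ∂wienerPair := hswap.symm
        _ = ∫ ω, X (z, ω) ∂wienerPair := by
            refine integral_congr_ae (ae_of_all _ fun ω => ?_)
            simp only [hX]
            rw [integral_of_le hτ]
    rw [hid]
    -- Jensen: `(E_W X_z)² ≤ E_W X_z²`
    have hmem : MemLp (fun ω => X (z, ω)) 2 wienerPair :=
      (memLp_two_iff_integrable_sq h2.aestronglyMeasurable).2 h3
    have hvar := variance_nonneg (fun ω => X (z, ω)) wienerPair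
    rw [variance_eq_sub hmem] at hvar
    simp only [Pi.pow_apply] at hvar
    linarith
  -- integrate the a.e. inequality
  have hR : Integrable (fun z => ∫ ω, X (z, ω) ^ 2 ∂wienerPair) ((pinnedChain ω₂ lam β γ).gibbsMeasure N T) :=
    hX2i.integral_prod_left
  have hRint : ∫ z, ∫ ω, X (z, ω) ^ 2 ∂wienerPair ∂((pinnedChain ω₂ lam β γ).gibbsMeasure N T) =
      ∫ p, X p ^ 2 ∂(((pinnedChain ω₂ lam β γ).gibbsMeasure N T).prod wienerPair) :=
    (integral_prod _ hX2i).symm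
  rw [← hRint]
  by_cases hgi : Integrable (fun z => (∫ u in (0 : ℝ)..τ, ∫ y, θ y
      ∂((pinnedChain ω₂ lam β γ).transitionKernel N T T u.toNNReal z)) ^ 2) ((pinnedChain ω₂ lam β γ).gibbsMeasure N T)
  · exact integral_mono_ae hgi hR hpt
  · rw [integral_undef hgi]
    exact integral_nonneg fun z => integral_nonneg fun ω => sq_nonneg _

end Jensen

/-! ## §2  The affine ceiling for `N ≥ 2` -/

/-- **The free affine ceiling, `N ≥ 2` (PROVED):** for the pinned anharmonic chain (all parameters `> 0`) and `T > 0` there is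
`B` (`= 4σ²/γ²`, `σ²` the landed `N`-uniform static bound `E_{μ_T}[e₀²] ≤ σ²`) with `‖g^τ_{N,T}‖² ≤ (2T²/γ)·τ + B` for every
`N ≥ 2` and every `τ ≥ 0`.  (`AffineCorrectorCeiling` as typed also asks `N ∈ {0, 1}`; `N = 0` is trivial, `N = 1` — both baths on
one site, no bond — is true but outside the landed bath-bond calculus.) [this file] -/
theorem affineCorrectorCeiling_two :
    ∀ ω₂ lam β γ : ℝ, 0 < ω₂ → 0 < lam → 0 < β → 0 < γ → ∀ T : ℝ, 0 < T →
      ∃ B : ℝ, ∀ N : ℕ, 2 ≤ N → ∀ τ : ℝ, 0 ≤ τ →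
        correctorNormSq ω₂ lam β γ T N τ ≤ 2 * T ^ 2 / γ * τ + B := by
  intro ω₂ lam β γ hω hl hβ hγ T hT
  obtain ⟨σ2, hσ⟩ := localEnergyMoment ω₂ lam β γ hω hl hβ hγ T hT
  refine ⟨4 * σ2 / γ ^ 2, fun N hN2 τ hτ => ?_⟩
  have hN : 1 < N := by omega
  have hN0 : 0 < N := Nat.zero_lt_of_lt hN
  unfold correctorNormSq
  rw [dif_pos hN0]
  set P := pinnedChain ω₂ lam β γ with hP
  -- the boundary kernel `K_N`, its iterated primitive, and the Cesàro deficit `W_N`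
  set K : ℝ → ℝ := fun u => ∫ z, ((z.2 ⟨0, hN0⟩) ^ 2 - T) *
      (∫ y, ((y.2 ⟨0, hN0⟩) ^ 2 - T) ∂(P.transitionKernel N T T u.toNNReal z)) ∂(P.gibbsMeasure N T) with hK
  set F : ℝ → ℝ := fun s => ∫ u in (0 : ℝ)..s, K u with hF
  -- (a) conditional Jensen + (b) second moment of the time integral = `2∫(τ−r)K = 2∫F`
  have hJ := correctorNormSq_le_timeIntegral_sq hω hl hβ hγ hT hN0 hτ
  have hinv : ∀ s : ℝ≥0, (P.gibbsMeasure N T).bind (P.transitionKernel N T T s) = P.gibbsMeasure N T := fun s =>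
    pinnedChain_gibbsMeasure_bind_transitionKernel hω hl.le hβ.le hγ.le hN0 hT s
  haveI : IsProbabilityMeasure (P.gibbsMeasure N T) := pinnedChain_isProbabilityMeasure_gibbsMeasure hω hl.le hβ.le γ N hT
  have hKm : Measurable (fun y : PhaseSpace N => (y.2 ⟨0, hN0⟩) ^ 2 - T) := by fun_prop
  have hK2 := pinnedChain_integrable_sq_kinObs₀ (γ := γ) hω hl hβ hT hN0
  have hsq := pinnedChain_timeIntegral_sq ω₂ lam β γ hω hl.le hβ.le hγ.le N T T (P.gibbsMeasure N T) hinv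
    (fun y : PhaseSpace N => (y.2 ⟨0, hN0⟩) ^ 2 - T) hKm hK2 τ hτ
  have htri := pinnedChain_primitive_kinKernel_integral_eq (γ := γ) hω hl hβ hγ hT hN0 hτ
  -- so `‖g^τ‖² ≤ 2 ∫₀^τ F`
  have h1 : ∫ z, (∫ u in (0 : ℝ)..τ, ∫ y, ((y.2 ⟨0, hN0⟩) ^ 2 - T)
        ∂(P.transitionKernel N T T u.toNNReal z)) ^ 2 ∂(P.gibbsMeasure N T) ≤ 2 * ∫ s in (0 : ℝ)..τ, F s := by
    have h := hJ.trans_eq hsq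
    rw [← htri] at h
    simpa only [hF, hK] using h
  -- (c) the bath-bond reduction `0 ≤ V_N(0,τ) ≤ 4γT²·W_N(τ) + 8E[e₀²]`, `E[e₀²] ≤ σ²`
  have hred := stub_bathBondReduction_of_kernelFacts ω₂ lam β γ hω hl hβ hγ T hT N hN
    (stub_kernelDetailedBalance ω₂ lam β γ hω hl hβ hγ T hT N hN)
    (stub_siteEnergyDynkin ω₂ lam β γ hω hl hβ hγ T hT N hN)
    (stub_siteEnergyCurrentCovariance ω₂ lam β γ hω hl hβ hγ T hT N hN) τ hτ
  have hV0 := pinnedChain_bondHeatVar_nonneg hω hl.le hβ hγ hN0 hT ⟨0, hN0⟩ hτ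
  have hmom := hσ N hN
  -- `W_N(τ) = τ − (γ/T²)∫₀^τ F`
  obtain ⟨-, hKc, -, -, -⟩ := boundaryKernelBasics_proof ω₂ lam β γ hω hl hβ hγ T hT N hN0
  simp only [dif_pos hN0] at hKc
  have hFc : Continuous F := intervalIntegral.continuous_primitive (fun a b => hKc.intervalIntegrable a b) 0
  have hFi : IntervalIntegrable F volume 0 τ := hFc.intervalIntegrable 0 τ
  have hFi' : IntervalIntegrable (fun s => γ / T ^ 2 * F s) volume 0 τ := hFi.const_mul _
  have hsplit : ∫ s in (0 : ℝ)..τ, (1 - γ / T ^ 2 * F s) = τ - γ / T ^ 2 * ∫ s in (0 : ℝ)..τ, F s := by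
    rw [intervalIntegral.integral_sub intervalIntegrable_const hFi', intervalIntegral.integral_const,
      intervalIntegral.integral_const_mul, sub_zero, smul_eq_mul, mul_one]
  have hW : 2 * (∫ s in (0:ℝ)..τ, (τ - s) * ∫ z, P.bondCurrent N ⟨0, hN0⟩ z *
        (∫ y, P.bondCurrent N ⟨0, hN0⟩ y ∂(P.transitionKernel N T T s.toNNReal z)) ∂(P.gibbsMeasure N T)) ≤
      4 * γ * T ^ 2 * (τ - γ / T ^ 2 * ∫ s in (0 : ℝ)..τ, F s) + 8 * σ2 := by
    have h := hred
    rw [show (∫ s in (0 : ℝ)..τ, (1 - γ / T ^ 2 * ∫ u in (0 : ℝ)..s,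
        ∫ z, ((z.2 ⟨0, Nat.zero_lt_of_lt hN⟩) ^ 2 - T) *
          (∫ y, ((y.2 ⟨0, Nat.zero_lt_of_lt hN⟩) ^ 2 - T) ∂(P.transitionKernel N T T u.toNNReal z))
            ∂(P.gibbsMeasure N T))) = τ - γ / T ^ 2 * ∫ s in (0 : ℝ)..τ, F s from hsplit] at h
    linarith
  -- combine: `(γ/T²)·∫F ≤ ... `
  have hγT : 0 < γ / T ^ 2 := div_pos hγ (by positivity)
  have hT2 : 0 < T ^ 2 := by positivity
  -- from `0 ≤ V ≤ 4γT²(τ − (γ/T²)∫F) + 8σ²`: `4γ²·∫F ≤ 4γT²τ + 8σ²`, i.e. `2∫F ≤ (2T²/γ)τ + 4σ²/γ²`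
  have hkey : 2 * ∫ s in (0 : ℝ)..τ, F s ≤ 2 * T ^ 2 / γ * τ + 4 * σ2 / γ ^ 2 := by
    have h0 : 0 ≤ 4 * γ * T ^ 2 * (τ - γ / T ^ 2 * ∫ s in (0 : ℝ)..τ, F s) + 8 * σ2 := hV0.trans hW
    have ha : T ^ 2 * (γ / T ^ 2 * ∫ s in (0 : ℝ)..τ, F s) = γ * ∫ s in (0 : ℝ)..τ, F s := by
      field_simp
    have h0' : 0 ≤ 4 * γ * T ^ 2 * τ - 4 * γ ^ 2 * (∫ s in (0 : ℝ)..τ, F s) + 8 * σ2 := by nlinarith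
    have hγ2 : 0 < γ ^ 2 := by positivity
    have h3 : 2 * (∫ s in (0 : ℝ)..τ, F s) * γ ^ 2 ≤ (2 * T ^ 2 / γ * τ + 4 * σ2 / γ ^ 2) * γ ^ 2 := by
      have e : (2 * T ^ 2 / γ * τ + 4 * σ2 / γ ^ 2) * γ ^ 2 = 2 * γ * T ^ 2 * τ + 4 * σ2 := by
        field_simp
      rw [e]
      nlinarith
    exact le_of_mul_le_mul_right h3 hγ2
  exact h1.trans hkey

/-! ## §3  The horizon rungs `s ≤ 1` at `N₀ = 2` -/

/-- **`KCB^{(s)}` for every `s ≤ 1`, with `N₀ = 2`, from the proved affine ceiling** (`τ ≤ N^s ≤ N` for `N ≥ 1`,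
`C_T = 2T²/γ + max B 0`). [this file] -/
theorem horizonCorrectorBudget_of_affineCeiling_two_of_le_one {s : ℝ} (hs : s ≤ 1) : HorizonCorrectorBudget s := by
  intro ω₂ lam β γ hω hl hβ hγ T hT
  obtain ⟨B, hB⟩ := affineCorrectorCeiling_two ω₂ lam β γ hω hl hβ hγ T hT
  refine ⟨2 * T ^ 2 / γ + max B 0, 2, fun N hN τ hτ hτs => ?_⟩
  have hN1 : (1 : ℝ) ≤ N := by exact_mod_cast (show 1 ≤ N by omega)
  have hτN : τ ≤ (N : ℝ) := hτs.trans ((Real.rpow_le_rpow_of_exponent_le hN1 hs).trans_eq (Real.rpow_one _))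
  have h := hB N hN τ hτ
  have hc : 0 ≤ 2 * T ^ 2 / γ := by positivity
  have hB0 : B ≤ max B 0 * (N : ℝ) :=
    (le_max_left B 0).trans (le_mul_of_one_le_right (le_max_right B 0) hN1)
  calc correctorNormSq ω₂ lam β γ T N τ ≤ 2 * T ^ 2 / γ * τ + B := h
    _ ≤ 2 * T ^ 2 / γ * (N : ℝ) + max B 0 * (N : ℝ) := add_le_add (mul_le_mul_of_nonneg_left hτN hc) hB0
    _ = (2 * T ^ 2 / γ + max B 0) * (N : ℝ) := by ring

end Summit.AtomisticToContinuum.FouriersLaw.Theorems.SubdiffusiveBondHeat.CorrectorBudget.Ladder
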